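import Mathlib.Analysis.SpecialFunctions.Complex.Circle
import Mathlib.Analysis.SpecialFunctions.Trigonometric.Deriv
import Mathlib.Analysis.Calculus.IteratedDeriv.Lemmas
import HarnessLib

/-!
# The Weyl denominator `ρ′Δ` of `U(2,1)` on the rays through the compact wall: `ρ′Δ = 4i·sin s·(cos(ψ−3t) − cos s)`, and its wall jets (ROAD A (A4-iv-a))

Topic `NumberTheory/Rogawski1990`; namespace `Literature.NumberTheory.Rogawski1990`.  THEOREMS ONLY (no `def`, no instance, no notation, no axiom, no named fact,
no `sorry`).  Cell `pub/hodgecm-mathlib`, ENGINE T1 (crux H413 = `stmt-HodgeConjecture-24833`); floor-1½, count-neutral, under row (S-d) ∕ «SdArch» ED. 3 node N1 = the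
(L_{U(2,1)}) letter ★ `ArchCentralLimitFormulaRankTwo` (`stub_ArchCentralLimitU21`): brick (A4-iv-a) of the (A4) VALUE computation (census
`F0/P3a/F0P3a-p05/g13/CENSUS-A4-ValueInTheChart.F0P3a-p05g13.md` §1 (1a); author F0P3a-p05 (g13), 2026-09-01).  Companion of ★ p06 `ArchCentralLimitFunctionalWallAlgebra`
(`Λ₈[G](z) = ¼·((d∕dt)²|₀(d∕ds)|₀ G(z·e^{i(tA⃗+sN⃗)}) − (d∕ds)³|₀ G(z·e^{isN⃗}))`, `N⃗ = (1,−1,0)`, `A⃗ = (1,1,−2)`), which is `ρ′Δ`-agnostic: here is `ρ′Δ` itself on those rays.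

THE MATHEMATICS.  The letter's normaliser is `ρ(z)′Δ(z) = z₀z₂⁻¹·(1 − z₁z₀⁻¹)(1 − z₂z₀⁻¹)(1 − z₂z₁⁻¹)` (Rogawski p. 126: `ρ(γ) = e^{i(θ₁−θ₃)}`, `′Δ(γ) = ∏(1 − e^{i(θ_j−θ_i)})`; `= Δ_HC`,
`W`-skew).  At the compact-wall point `(w, w, w e^{iψ})` moved by `t` along `A⃗` and `s` along `N⃗`, i.e. `z = (w e^{i(t+s)}, w e^{i(t−s)}, w e^{iψ}e^{−2it})`, put `W = w e^{it}`,
`X = e^{is}`, `Y = e^{i(ψ−3t)}`: then `z = (WX, WX⁻¹, WY)` and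
  `ρ′Δ(z) = (X∕Y)(1 − X⁻²)(1 − Y∕X)(1 − XY) = (X − X⁻¹)(Y + Y⁻¹ − X − X⁻¹) = 4i·sin s·(cos(ψ − 3t) − cos s)`.
Consequences (the wall jets the (A4) assembler needs, `θ := ψ − 3t`): `ρ′Δ|_{s=0} = 0` (the compact wall), odd in `s`;
  `N(ρ′Δ)|_{wall} = (d∕ds)|₀ = 4i(cos θ − 1)`,   `N³(ρ′Δ)|_{wall} = (d∕ds)³|₀ = 4i(4 − cos θ)`,   `(d∕dt)²|₀ (d∕ds)|₀ = −36i·cos ψ`,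
hence **`¼·(A′²N − N³)(ρ′Δ)|_{wall}(ψ) = −4i(2cos ψ + 1)`, `= −12i` at the centre** — the cross-check value quoted in ★ p842205's docstring («`ω(ρ′Δ)(ζ•1) = −12i`»), now a theorem.
With `|v − u|² = 2(1 − cos ψ)` (★-to-be `UnitBallKCentralOrbitalIntegralChart.norm_sub_sq_eq_of_circle`) the first jet says: the normal wall jet of `F_Θ = ρ′Δ·Φ_Θ` is
`N F_Θ|_{wall} = 4i(cosψ − 1)·Φ_Θ(k_ψ) = −2i·c_μ·(ε²-normalised K-central sheet integral)` EXACTLY (census (1b)).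

* §1 `rhoWeylDelta_units_eq` (the unit identity), `exp_sub_mul_eq_four_I_sin_mul` (the trigonometric reading);
* §2 **`rhoWeylDelta_compactWall_rays`** (both rays, in `Circle` tokens), `rhoWeylDelta_compactWall_normalRay` (`t = 0`);
* §3 jets: `hasDerivAt_wallDenominator`, `deriv_wallDenominator(_zero)`, `hasDerivAt_wallDenominator_deriv(_two)`, **`iteratedDeriv_three_wallDenominator_zero`**,
  **`iteratedDeriv_two_deriv_wallDenominator_zero`**, **`quarter_wall_jets_wallDenominator`** (`= −4i(2cos ψ + 1)`), `quarter_wall_jets_wallDenominator_centre` (`= −12i`).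
HONEST LABEL: HC_CM is proved only modulo the printed citations until rung 0 closes; this file is trigonometry and pays nothing by itself.

## References
* [Rogawski1990] J. D. Rogawski, *Automorphic Representations of Unitary Groups in Three Variables*, Ann. of Math. Stud. 123 (1990), §8.4 pp. 126–127 (the normaliser `ρ′Δ`, the operator `ω`,
  `c_{G′} = 3c_G`).
* [Varadarajan1989] V. S. Varadarajan, *An Introduction to Harmonic Analysis on Semisimple Lie Groups* (1989), §6.4 (the Weyl denominator on a compact Cartan and its wall behaviour).
-/

noncomputable section

open Complex

namespace Literature.NumberTheory.Rogawski1990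

/-! ### §1 The algebraic identity -/

/-- THE UNIT IDENTITY behind the wall form of the Weyl denominator: for units `W, X, Y` and `a = WX`, `b = WX⁻¹`, `d = WY`,
`(a∕d)(1 − b∕a)(1 − d∕a)(1 − d∕b) = (X − X⁻¹)(Y + Y⁻¹ − X − X⁻¹)`. [cite: Rogawski1990, §8.4 p. 126] -/
theorem rhoWeylDelta_units_eq (W X Y : ℂ) (hW : W ≠ 0) (hX : X ≠ 0) (hY : Y ≠ 0) :
    (W * X) * (W * Y)⁻¹ * ((1 - (W * X⁻¹) * (W * X)⁻¹) * (1 - (W * Y) * (W * X)⁻¹) * (1 - (W * Y) * (W * X⁻¹)⁻¹)) =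
      (X - X⁻¹) * (Y + Y⁻¹ - X - X⁻¹) := by
  field_simp
  ring

/-- THE TRIGONOMETRIC READING: `(e^{is} − e^{−is})(e^{iθ} + e^{−iθ} − e^{is} − e^{−is}) = 4i·sin s·(cos θ − cos s)` for real `s, θ`. [cite: Rogawski1990, §8.4 p. 126] -/
theorem exp_sub_mul_eq_four_I_sin_mul (s θ : ℝ) :
    (exp (s * I) - (exp (s * I))⁻¹) * (exp (θ * I) + (exp (θ * I))⁻¹ - exp (s * I) - (exp (s * I))⁻¹) =
      4 * I * Real.sin s * (Real.cos θ - Real.cos s) := by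
  rw [ofReal_sin, ofReal_cos, ofReal_cos, ← Complex.exp_neg, ← Complex.exp_neg]
  have hs : 2 * Complex.sin s = (exp (-(s : ℂ) * I) - exp ((s : ℂ) * I)) * I := two_sin _
  have hc : 2 * Complex.cos s = exp ((s : ℂ) * I) + exp (-(s : ℂ) * I) := two_cos _
  have hθ : 2 * Complex.cos θ = exp ((θ : ℂ) * I) + exp (-(θ : ℂ) * I) := two_cos _
  have h4 : 4 * I * Complex.sin s * (Complex.cos θ - Complex.cos s) = I * (2 * Complex.sin s) * ((2 * Complex.cos θ) - (2 * Complex.cos s)) := by ring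
  rw [h4, hs, hc, hθ, neg_mul, neg_mul]
  ring_nf
  rw [I_sq]
  ring

/-! ### §2 The Weyl denominator of the letter on the rays through a compact-wall point -/

/-- **THE WEYL DENOMINATOR ON THE WALL RAYS.**  For the letter's normaliser `ρ(z)′Δ(z) = z₀z₂⁻¹·(1 − z₁z₀⁻¹)(1 − z₂z₀⁻¹)(1 − z₂z₁⁻¹)` (★ `ArchCentralLimitFormulaRankTwo`),
at the point `z = (w e^{i(t+s)}, w e^{i(t−s)}, w e^{iψ} e^{−2it})` — i.e. the compact-wall point `(w, w, w e^{iψ})` moved by `t` along the wall-tangent ray `A⃗ = (1,1,−2)` and by `s` along the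
wall-normal ray `N⃗ = (1,−1,0)` of ★ `ArchCentralLimitFunctionalWallAlgebra` —
  `ρ′Δ(z) = 4i · sin s · (cos(ψ − 3t) − cos s)`.
In particular `ρ′Δ` vanishes on the compact wall (`s = 0`) and is odd in `s`. [cite: Rogawski1990, §8.4 pp. 126–127] -/
theorem rhoWeylDelta_compactWall_rays (w : Circle) (ψ t s : ℝ) :
    ((w * Circle.exp (t + s) : Circle) : ℂ) * (((w * Circle.exp ψ * Circle.exp (-2 * t) : Circle) : ℂ))⁻¹ *
      ((1 - ((w * Circle.exp (t - s) : Circle) : ℂ) * (((w * Circle.exp (t + s) : Circle) : ℂ))⁻¹) *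
        (1 - ((w * Circle.exp ψ * Circle.exp (-2 * t) : Circle) : ℂ) * (((w * Circle.exp (t + s) : Circle) : ℂ))⁻¹) *
        (1 - ((w * Circle.exp ψ * Circle.exp (-2 * t) : Circle) : ℂ) * (((w * Circle.exp (t - s) : Circle) : ℂ))⁻¹)) =
      4 * I * Real.sin s * (Real.cos (ψ - 3 * t) - Real.cos s) := by
  -- units: `W = w e^{it}`, `X = e^{is}`, `Y = e^{i(ψ − 3t)}`
  have hWX : ((w * Circle.exp (t + s) : Circle) : ℂ) = ((w : ℂ) * exp (t * I)) * exp (s * I) := by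
    rw [Circle.coe_mul, Circle.coe_exp, mul_assoc, ← Complex.exp_add]
    congr 1; push_cast; ring_nf
  have hWXi : ((w * Circle.exp (t - s) : Circle) : ℂ) = ((w : ℂ) * exp (t * I)) * (exp (s * I))⁻¹ := by
    rw [Circle.coe_mul, Circle.coe_exp, ← Complex.exp_neg, mul_assoc, ← Complex.exp_add]
    congr 1; push_cast; ring_nf
  have hWY : ((w * Circle.exp ψ * Circle.exp (-2 * t) : Circle) : ℂ) = ((w : ℂ) * exp (t * I)) * exp ((ψ - 3 * t : ℝ) * I) := by
    rw [Circle.coe_mul, Circle.coe_mul, Circle.coe_exp, Circle.coe_exp, mul_assoc, mul_assoc, ← Complex.exp_add, ← Complex.exp_add]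
    congr 1; push_cast; ring_nf
  have hW : (w : ℂ) * exp (t * I) ≠ 0 := mul_ne_zero w.coe_ne_zero (Complex.exp_ne_zero _)
  rw [hWX, hWXi, hWY, rhoWeylDelta_units_eq _ _ _ hW (Complex.exp_ne_zero _) (Complex.exp_ne_zero _)]
  exact_mod_cast exp_sub_mul_eq_four_I_sin_mul s (ψ - 3 * t)

/-- The NORMAL ray alone (`t = 0`): `ρ′Δ(w e^{is}, w e^{−is}, w e^{iψ}) = 4i·sin s·(cos ψ − cos s)`. [cite: Rogawski1990, §8.4 pp. 126–127] -/
theorem rhoWeylDelta_compactWall_normalRay (w : Circle) (ψ s : ℝ) :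
    ((w * Circle.exp s : Circle) : ℂ) * (((w * Circle.exp ψ : Circle) : ℂ))⁻¹ *
      ((1 - ((w * Circle.exp (-s) : Circle) : ℂ) * (((w * Circle.exp s : Circle) : ℂ))⁻¹) *
        (1 - ((w * Circle.exp ψ : Circle) : ℂ) * (((w * Circle.exp s : Circle) : ℂ))⁻¹) *
        (1 - ((w * Circle.exp ψ : Circle) : ℂ) * (((w * Circle.exp (-s) : Circle) : ℂ))⁻¹)) =
      4 * I * Real.sin s * (Real.cos ψ - Real.cos s) := by
  have h := rhoWeylDelta_compactWall_rays w ψ 0 s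
  simp only [zero_add, zero_sub, mul_zero, sub_zero, Circle.exp_zero, mul_one] at h
  exact h

/-! ### §3 The wall jets of the denominator -/

/-- `s ↦ 4i·sin s·(cos θ − cos s)` has derivative `4i·(cos s·(cos θ − cos s) + sin s·sin s)`. [cite: Rogawski1990, §8.4 pp. 126–127] -/
theorem hasDerivAt_wallDenominator (θ s : ℝ) :
    HasDerivAt (fun s : ℝ => 4 * I * Real.sin s * (Real.cos θ - Real.cos s))
      (4 * I * (Real.cos s * (Real.cos θ - Real.cos s) + Real.sin s * Real.sin s)) s := by
  have h1 : HasDerivAt (fun s : ℝ => (Real.sin s : ℂ)) (Real.cos s : ℂ) s := (Real.hasDerivAt_sin s).ofReal_comp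
  have h2 : HasDerivAt (fun s : ℝ => ((Real.cos θ - Real.cos s : ℝ) : ℂ)) ((Real.sin s : ℝ) : ℂ) s := by
    have := ((Real.hasDerivAt_cos s).const_sub (Real.cos θ)).ofReal_comp
    simpa using this
  have h3 := ((h1.const_mul (4 * I)).mul h2)
  refine (h3.congr_of_eventuallyEq (Filter.Eventually.of_forall fun x => ?_)).congr_deriv ?_
  · simp only [Pi.mul_apply]; push_cast; ring
  · push_cast; ring

/-- **FIRST NORMAL JET** `N(ρ′Δ)|_{wall} = 4i(cos θ − 1)`: `deriv (s ↦ 4i·sin s·(cos θ − cos s)) 0 = 4i(cos θ − 1)`. [cite: Rogawski1990, §8.4 pp. 126–127] -/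
theorem deriv_wallDenominator_zero (θ : ℝ) :
    deriv (fun s : ℝ => 4 * I * Real.sin s * (Real.cos θ - Real.cos s)) 0 = 4 * I * (Real.cos θ - 1) := by
  rw [(hasDerivAt_wallDenominator θ 0).deriv, Real.cos_zero, Real.sin_zero]
  push_cast
  ring

/-- `deriv` of the wall denominator as a function. [cite: Rogawski1990, §8.4 pp. 126–127] -/
theorem deriv_wallDenominator (θ : ℝ) :
    deriv (fun s : ℝ => 4 * I * Real.sin s * (Real.cos θ - Real.cos s)) =
      fun s : ℝ => 4 * I * (Real.cos s * (Real.cos θ - Real.cos s) + Real.sin s * Real.sin s) :=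
  funext fun s => (hasDerivAt_wallDenominator θ s).deriv

/-- Second derivative along the normal ray: `(d∕ds)[4i(cos s(cos θ − cos s) + sin² s)] = 4i·sin s·(4cos s − cos θ)`. [cite: Rogawski1990, §8.4 pp. 126–127] -/
theorem hasDerivAt_wallDenominator_deriv (θ s : ℝ) :
    HasDerivAt (fun s : ℝ => 4 * I * (Real.cos s * (Real.cos θ - Real.cos s) + Real.sin s * Real.sin s))
      (4 * I * (Real.sin s * (4 * Real.cos s - Real.cos θ))) s := by
  have hc : HasDerivAt (fun s : ℝ => (Real.cos s : ℂ)) (-(Real.sin s) : ℂ) s := by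
    simpa using (Real.hasDerivAt_cos s).ofReal_comp
  have hs : HasDerivAt (fun s : ℝ => (Real.sin s : ℂ)) (Real.cos s : ℂ) s := (Real.hasDerivAt_sin s).ofReal_comp
  have h := ((hc.mul ((hasDerivAt_const s (Real.cos θ : ℂ)).sub hc)).add (hs.mul hs)).const_mul (4 * I)
  refine (h.congr_of_eventuallyEq (Filter.Eventually.of_forall fun x => ?_)).congr_deriv ?_
  · simp only [Pi.mul_apply, Pi.add_apply, Pi.sub_apply]
  · simp only [Pi.sub_apply]; push_cast; ring

/-- Third derivative along the normal ray: `(d∕ds)[4i·sin s·(4cos s − cos θ)] = 4i·(4cos²s − cos s·cos θ − 4sin²s)`. [cite: Rogawski1990, §8.4 pp. 126–127] -/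
theorem hasDerivAt_wallDenominator_deriv_two (θ s : ℝ) :
    HasDerivAt (fun s : ℝ => 4 * I * (Real.sin s * (4 * Real.cos s - Real.cos θ)))
      (4 * I * (4 * Real.cos s * Real.cos s - Real.cos s * Real.cos θ - 4 * Real.sin s * Real.sin s)) s := by
  have hc : HasDerivAt (fun s : ℝ => (Real.cos s : ℂ)) (-(Real.sin s) : ℂ) s := by
    simpa using (Real.hasDerivAt_cos s).ofReal_comp
  have hs : HasDerivAt (fun s : ℝ => (Real.sin s : ℂ)) (Real.cos s : ℂ) s := (Real.hasDerivAt_sin s).ofReal_comp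
  have h := (hs.mul ((hc.const_mul (4 : ℂ)).sub (hasDerivAt_const s (Real.cos θ : ℂ)))).const_mul (4 * I)
  refine (h.congr_of_eventuallyEq (Filter.Eventually.of_forall fun x => ?_)).congr_deriv ?_
  · simp only [Pi.mul_apply, Pi.sub_apply]
  · simp only [Pi.sub_apply]; push_cast; ring

/-- **THIRD NORMAL JET** `N³(ρ′Δ)|_{wall} = 4i(4 − cos θ)`: `iteratedDeriv 3 (s ↦ 4i·sin s·(cos θ − cos s)) 0 = 4i(4 − cos θ)`. [cite: Rogawski1990, §8.4 pp. 126–127] -/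
theorem iteratedDeriv_three_wallDenominator_zero (θ : ℝ) :
    iteratedDeriv 3 (fun s : ℝ => 4 * I * Real.sin s * (Real.cos θ - Real.cos s)) 0 = 4 * I * (4 - Real.cos θ) := by
  have h2 : deriv (fun s : ℝ => 4 * I * (Real.cos s * (Real.cos θ - Real.cos s) + Real.sin s * Real.sin s)) =
      fun s : ℝ => 4 * I * (Real.sin s * (4 * Real.cos s - Real.cos θ)) := funext fun s => (hasDerivAt_wallDenominator_deriv θ s).deriv
  rw [iteratedDeriv_succ, iteratedDeriv_succ, iteratedDeriv_one, deriv_wallDenominator, h2, (hasDerivAt_wallDenominator_deriv_two θ 0).deriv,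
    Real.cos_zero, Real.sin_zero]
  push_cast
  ring

/-- **THE TANGENT–TANGENT–NORMAL JET** `A′²N(ρ′Δ)|_{wall} = −36i·cos ψ`: along the combined rays the first normal jet is `t ↦ 4i(cos(ψ−3t) − 1)`, whose second
`t`-derivative at `0` is `−36i cos ψ`. [cite: Rogawski1990, §8.4 pp. 126–127] -/
theorem iteratedDeriv_two_deriv_wallDenominator_zero (ψ : ℝ) :
    iteratedDeriv 2 (fun t : ℝ => deriv (fun s : ℝ => 4 * I * Real.sin s * (Real.cos (ψ - 3 * t) - Real.cos s)) 0) 0 = -36 * I * Real.cos ψ := by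
  have h1 : (fun t : ℝ => deriv (fun s : ℝ => 4 * I * Real.sin s * (Real.cos (ψ - 3 * t) - Real.cos s)) 0) = fun t : ℝ => 4 * I * ((Real.cos (ψ - 3 * t) : ℂ) - 1) := by
    funext t
    rw [deriv_wallDenominator_zero (ψ - 3 * t)]
  have hc : ∀ t : ℝ, HasDerivAt (fun t : ℝ => (Real.cos (ψ - 3 * t) : ℂ)) ((3 * Real.sin (ψ - 3 * t) : ℝ) : ℂ) t := by
    intro t
    have hlin : HasDerivAt (fun t : ℝ => ψ - 3 * t) (-3) t := by simpa using ((hasDerivAt_id t).const_mul 3).const_sub ψ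
    have := ((Real.hasDerivAt_cos (ψ - 3 * t)).comp t hlin).ofReal_comp
    refine this.congr_deriv ?_
    push_cast; ring
  have hs : ∀ t : ℝ, HasDerivAt (fun t : ℝ => ((3 * Real.sin (ψ - 3 * t) : ℝ) : ℂ)) ((-9 * Real.cos (ψ - 3 * t) : ℝ) : ℂ) t := by
    intro t
    have hlin : HasDerivAt (fun t : ℝ => ψ - 3 * t) (-3) t := by simpa using ((hasDerivAt_id t).const_mul 3).const_sub ψ
    have := (((Real.hasDerivAt_sin (ψ - 3 * t)).comp t hlin).const_mul 3).ofReal_comp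
    refine this.congr_deriv ?_
    push_cast; ring
  have hd1 : deriv (fun t : ℝ => 4 * I * ((Real.cos (ψ - 3 * t) : ℂ) - 1)) = fun t : ℝ => 4 * I * ((3 * Real.sin (ψ - 3 * t) : ℝ) : ℂ) := by
    funext t
    exact (((hc t).sub_const (1 : ℂ)).const_mul (4 * I)).deriv
  have hd2 : deriv (fun t : ℝ => 4 * I * ((3 * Real.sin (ψ - 3 * t) : ℝ) : ℂ)) 0 = 4 * I * ((-9 * Real.cos (ψ - 3 * 0) : ℝ) : ℂ) :=
    ((hs 0).const_mul (4 * I)).deriv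
  rw [h1, iteratedDeriv_succ, iteratedDeriv_one, hd1, hd2, mul_zero, sub_zero]
  push_cast
  ring

/-- **THE WALL VALUE OF `Λ₈[ρ′Δ]`**: `¼·(A′²N − N³)(ρ′Δ)` at the compact-wall point `(w, w, w e^{iψ})` equals `−4i·(2cos ψ + 1)`; at the CENTRE (`ψ = 0`) this is `−12i`
— the cross-check value recorded in ★ `ArchCentralLimitFormulaRankTwo`'s docstring, here PROVED from the ray identity. [cite: Rogawski1990, §8.4 pp. 126–127] -/
theorem quarter_wall_jets_wallDenominator (ψ : ℝ) :
    (1 / 4 : ℂ) * (iteratedDeriv 2 (fun t : ℝ => deriv (fun s : ℝ => 4 * I * Real.sin s * (Real.cos (ψ - 3 * t) - Real.cos s)) 0) 0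
        - iteratedDeriv 3 (fun s : ℝ => 4 * I * Real.sin s * (Real.cos ψ - Real.cos s)) 0) = -4 * I * (2 * Real.cos ψ + 1) := by
  rw [iteratedDeriv_two_deriv_wallDenominator_zero, iteratedDeriv_three_wallDenominator_zero]
  ring

/-- … `= −12i` at the centre. [cite: Rogawski1990, §8.4 pp. 126–127] -/
theorem quarter_wall_jets_wallDenominator_centre :
    (1 / 4 : ℂ) * (iteratedDeriv 2 (fun t : ℝ => deriv (fun s : ℝ => 4 * I * Real.sin s * (Real.cos (0 - 3 * t) - Real.cos s)) 0) 0
        - iteratedDeriv 3 (fun s : ℝ => 4 * I * Real.sin s * (Real.cos 0 - Real.cos s)) 0) = -12 * I := by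
  rw [quarter_wall_jets_wallDenominator 0, Real.cos_zero]
  push_cast
  ring

end Literature.NumberTheory.Rogawski1990

end
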